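import Mathlib.NumberTheory.Padics.PadicVal.Basic
import Literature.AlgebraicGeometry.Frobenioids.BirationalNormalizationExampleNotBiratNormalized
import HarnessLib

/-!
# Frobenioids I, Definition 4.5 (i): the universal closures of `IsBiratFrobeniusNormalized` and
# `IsOfModelType` are REFUTED (a concrete Example 4.6 datum) — PROOF-ONLY

Mochizuki, *The geometry of Frobenioids I: the general theory*, Kyushu J. Math. **62** (2008)
293–400, Definition 4.5 (i) kurims p. 86 and Example 4.6 pp. 86–87
[cite: MochizukiFrdI2008, Def. 4.5(i) p.86, Ex. 4.6 pp.86-87].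

FACT-LIST rows F-1115 (`PreFrobenioid.IsBiratFrobeniusNormalized`) and F-1116
(`PreFrobenioid.IsOfModelType`) of the abc-iut cell are Definition 4.5 (i) PREDICATES on a Frobenioid
(resp. on an object of one), typed in `ModelFrobenioidComparison.lean`; they are hypotheses ON DATA, not
closed facts. This proof-only file records the kernel event that classifies them: their universal
closures are FALSE. The witness is the paper's own Example 4.6 — "if the `ξ_p ≠ 0`, then `C` fails to be
of birationally Frobenius-normalized type" (p. 87) — whose conditional form
`Ex46.not_isBiratFrobeniusNormalized_A₀ (P : Ex46.Datum G) (hn : P.Ξ n ≠ 0)` is already in the tree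
(`BirationalNormalizationExampleNotBiratNormalized.lean`, seat abc-iut-L1-t8's Example 4.6 files); here
we supply a CONCRETE datum (`Ex46.exists_datum_Ξ_two_ne_zero`): `G = ℤ`, `ξ₂ = 2` and `ξ_p = 0` for
odd `p`, i.e. `Ξ(n) = Σ_p v_p(n)(n/p)ξ_p = n · v₂(n)`, whose Leibniz rule `Ξ(mn) = m Ξ(n) + n Ξ(m)` is
the additivity `v₂(mn) = v₂(m) + v₂(n)` of the `2`-adic valuation, and for which `Ξ(2) = 2 ≠ 0`.

Consequences (all PROVED, axioms standard):
* `Ex46.exists_frobeniusNormalized_not_biratFrobeniusNormalized` — there IS a datum whose Frobenioid is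
  of Frobenius-normalized type but not of birationally Frobenius-normalized type (Example 4.6's headline,
  now unconditional);
* `PreFrobenioid.not_forall_isBiratFrobeniusNormalized` — `¬ ∀ (data), IsBiratFrobeniusNormalized …`
  (universal closure of F-1115 refuted);
* `PreFrobenioid.not_forall_isOfModelType` — `¬ ∀ (data), IsOfModelType …` (universal closure of
  F-1116 refuted: its second conjunct fails at `A₀`).

Instance forms (R5: the predicate AT NAMED INSTANCES) are separate, already-landed theorems
(`PadicFrobenioidModelType.lean`, `ArchimedeanBiratNormalized.lean`, `ModelFrobenioidModelType.lean`,
`UnitTrivialModelType.lean`, `BiratFrobeniusNormalizedCriterion.lean`). A refuted universal closure says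
the row is a hypothesis on data, not that anything in print is false; no statement of the paper is
strengthened; nothing here takes a side on [IUTchIII] Cor. 3.12.
-/

namespace Literature.AlgebraicGeometry.Frobenioids

open CategoryTheory

namespace Ex46

/-- **A concrete datum for Example 4.6 with `ξ₂ ≠ 0`**: `G = ℤ`, `Ξ(n) = n · v₂(n)` (i.e. `ξ₂ = 2`,
`ξ_p = 0` for odd `p`); Leibniz rule = additivity of `v₂`; `Ξ(2) = 2 ≠ 0`.
[cite: MochizukiFrdI2008, Ex. 4.6 p.86] -/
theorem exists_datum_Ξ_two_ne_zero : ∃ P : Datum ℤ, P.Ξ 2 ≠ 0 := by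
  refine ⟨⟨fun n => (n : ℤ) * (padicValNat 2 n : ℤ), fun m n => ?_⟩, ?_⟩
  · have hm : (m : ℕ) ≠ 0 := m.ne_zero
    have hn : (n : ℕ) ≠ 0 := n.ne_zero
    simp only [PNat.mul_coe, padicValNat.mul hm hn, smul_eq_mul]
    push_cast
    ring
  · show ((2 : ℕ+) : ℕ) * (padicValNat 2 ((2 : ℕ+) : ℕ) : ℤ) ≠ 0
    simp

/-- **Example 4.6, unconditional headline**: for SOME datum (`ξ₂ = 2`) the Frobenioid `C` of Example 4.6
is of Frobenius-normalized type but NOT of birationally Frobenius-normalized type — "it is not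
necessarily the case that a Frobenioid of Frobenius-normalized type is of birationally
Frobenius-normalized type" (FrdI p. 86). [cite: MochizukiFrdI2008, Ex. 4.6 p.86] -/
theorem exists_frobeniusNormalized_not_biratFrobeniusNormalized :
    ∃ P : Datum ℤ, PreFrobenioid.IsOfType (PreFrobenioid.IsFrobeniusNormalized (toElem P)) ∧
      ¬ ∀ A : Obj P, PreFrobenioid.IsBiratFrobeniusNormalized (toElem P) (isFrobenioid P)
        (PreFrobenioid.hasBiratSquares_of_isFrobenioid (isFrobenioid P)) A := by
  obtain ⟨P, hP⟩ := exists_datum_Ξ_two_ne_zero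
  exact ⟨P, frobeniusNormalized_not_biratFrobeniusNormalized P hP⟩

end Ex46

namespace PreFrobenioid

/-- **F-1115: the universal closure of Definition 4.5 (i) `IsBiratFrobeniusNormalized` is FALSE** — not
every object of every Frobenioid is birationally Frobenius-normalized (witness: `A₀` in the Frobenioid of
Example 4.6 with `ξ₂ = 2`, FrdI p. 87). The row is a predicate on data (admissible at named instances
only). [cite: MochizukiFrdI2008, Ex. 4.6 p.87] -/
theorem not_forall_isBiratFrobeniusNormalized :
    ¬ ∀ (D : Type) [Category.{0} D] (Φ : Dᵒᵖ ⥤ CommMonCat.{0}) (C : Type) [Category.{0} C]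
        (F : C ⥤ ElemFrobenioid Φ) (hF : IsFrobenioid F) (hsq : HasBiratSquares F) (A : C),
        Literature.AlgebraicGeometry.Frobenioids.PreFrobenioid.IsBiratFrobeniusNormalized F hF hsq A := by
  obtain ⟨P, hP⟩ := Ex46.exists_datum_Ξ_two_ne_zero
  exact fun h => Ex46.not_isBiratFrobeniusNormalized_A₀ P hP (h _ _ _ _ _ _ _)

/-- **F-1116: the universal closure of Definition 4.5 (i) `IsOfModelType` is FALSE** — not every
Frobenioid is of model type (witness: the Frobenioid of Example 4.6 with `ξ₂ = 2`, which is not of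
birationally Frobenius-normalized type, so the second conjunct of "model type" fails at `A₀`). The row is
a predicate on data (admissible at named instances only). [cite: MochizukiFrdI2008, Def. 4.5(i) p.86] -/
theorem not_forall_isOfModelType :
    ¬ ∀ (D : Type) [Category.{0} D] (Φ : Dᵒᵖ ⥤ CommMonCat.{0}) (C : Type) [Category.{0} C]
        (F : C ⥤ ElemFrobenioid Φ) (hF : IsFrobenioid F) (hsq : HasBiratSquares F),
        Literature.AlgebraicGeometry.Frobenioids.PreFrobenioid.IsOfModelType F hF hsq := by
  obtain ⟨P, hP⟩ := Ex46.exists_datum_Ξ_two_ne_zero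
  exact fun h => Ex46.not_isBiratFrobeniusNormalized_A₀ P hP ((h _ _ _ _ _ _).2 (Ex46.A₀ P))

end PreFrobenioid

end Literature.AlgebraicGeometry.Frobenioids
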